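import Summits.QuantumFields.YangMills.Theorems.FluctuationComparisonRegPrIntLOrganTangentJensenHOfJvarH
import Summits.QuantumFields.YangMills.Theorems.FluctuationComparisonRegPrIntLOrganTangentTowerCutIterate
import Summits.QuantumFields.YangMills.Theorems.FluctuationComparisonRegPrIntLOrganTangentMultiWindowWeight
import Summits.QuantumFields.YangMills.Theorems.FluctuationComparisonRegPrIntLOrganTangentFibreMeanToolsAnyCut
import Literature.MathematicalPhysics.QuantumFieldTheory.Balaban1983to89.BalabanAdmissibleClassParams
import Literature.MathematicalPhysics.QuantumFieldTheory.Balaban1983to89.T4CubeChartExp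
import Literature.MathematicalPhysics.QuantumFieldTheory.Balaban1983to89.T3MinimiserStabilityReduction
import HarnessLib

/-!
# Crux `FluctuationComparisonRegPrIntL` (stmt-QuantumFields-20520, rung R3), PATH-B v18 organ O1ᵘ-H v2, LEAD w3 g25 BRICK 1 «TaylorCutH»
# (O1ᵘ-H v2 ⟸ LINᵘ-H ∧ JENᵘ-H) — END TO END ON THE JENSEN SIDE, **v18.1 EDITION** ((β) base window `49∕50·θBal`): **JENᵘ-H v18.1 ⟸ JVARᵘ-H v18.1, FOR EVERY FAMILY**
# (the m-step (A)-package and the multi-level-window weight are UNCONDITIONAL from a height, ✓(L16)∕✓(L19); the m-step Jensen gap is the integrated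
# tilted m-step fibre variance, ✓`…OrganTangentJensenGapKnitMW`; one-bond-pair clauses pass under the `t`-integral with the factor `1∕2`)

Cell `ym3-torus` (rung R3 = continuum `SU(2)` Yang–Mills on T³ — NOT d = 4, NOT infinite volume, NOT a mass gap, NOT Clay), width copy `ym3-torus-px5` (gen 19;
LEAD w3 g25 WORD №2 «px5 g19 JensenGapKnitMW: GO … dock §3 on JENᵘ-H = g25/JENuH.text.w3g25.txt 9b7b888f»).  `--kind proof --supports stmt-QuantumFields-20520
--as helper`, count-neutral, DEFINITION-FREE, default heartbeats, `autoImplicit false`; no registry ∕ binder ∕ `Lines/` edit.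

* CONCLUSION = **JENᵘ-H** = LEAD w3 g25's antecedent `hJ` of ✓∕⧗`…OrganTangentTaylorCutH.oneStepTransportUH_of_tangentH_jensenH` CHARACTER FOR CHARACTER (HOME
  `ym-ust-20520-w3/g25/JENuH.text.w3g25.txt`, sha16 9b7b888f44ab45e2): O1ᵘ-H v2's frame + seed H-clause; at a height `j₁ ≤ j < Ts`, for every disintegration `σ` of
  `dU_{Ts}` along `descendTo F ℰp j Ts` and every `window_j`-continuous version `mfun` of the `χ_{j,Ts}`-localised m-step fibre mean, a presentation `(c′, a′, w′, k′)`
  of the m-step JENSEN GAP `h_j − mfun` on the `θBal_j∕4`-window with `a′ + θ·x′ ≤ C·x·x + δ j` (second order; marginal slot kept, ideator g27 №10 (2)).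
* HYPOTHESIS `hJV` = **JVARᵘ-H** (this file's letter; sha16 of the text 327325e6b609df63, HOME `ym3-torus-px5/g19/JVARuH.text.px5g19.txt`): JENᵘ-H's prefix VERBATIM
  (regime, class parameters, `κ₀`, the head `∃ (θ r C w₀ : ℝ) (δ : ℕ → ℝ) (j₁ : ℕ)`, O1ᵘ-H v2's frame, the seed clause, the step `j`, ANY `σ`, ANY `mfun` with its a.e.
  identity), then FOR EVERY m-step (A)-package `(σ₀, lam)` of `descendTo F ℰp j Ts` on the multi-level window `MW_{j,Ts}` (Markov, bind, fibre, finite, (A1-MW),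
  (A2-MW), (A3-MW) — the binder texts of ✓(L16) `exists_height_regularSmallFieldDisintegration_descendTo` at `K := Ts`):
  `∃ w′ ≥ 0, θ·(w′∕(β_jθ_j²)) ≤ C·x·x + δ j ∧ ∃ k′ ≥ 0, rowMass_κ k′ ≤ w′ ∧ ∀ t ∈ [0,1]`, the one-bond-pair clause at `(θBal_j∕4, r, k′)` for
  `V ↦ Var[h_{Ts}; ((χ_{j,Ts}·ρ′_{Ts})·lam_V).tilted (t·h_{Ts})]`, `h_{Ts} = log ρ_{Ts} − log ρ′_{Ts}` — t-UNIFORM H-CLUSTERING OF THE TILTED m-STEP FIBRE VARIANCE OF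
  THE SEED DISCREPANCY (normalised by the tilt, hence independent of the package's weight `c`).
* ★★`jensenH_of_jvarH : JVARᵘ-H → JENᵘ-H`: `γ₁ := min γ₁ᴶ 1`, `j₁ := max j₁ᴶ (max jA jχ)` (✓(L16) §3, ✓(L19)); at each step the (A)-package from ✓(L16) and the
  weight letters from ✓(L19), the frame's clause ⑦ on `[j, Ts)` iterated by ✓(L18) `towerCut_iterate` for BOTH towers (the `ℝ≥0∞`-product weight = `ofReal` of the
  real weight, `ENNReal.ofReal_prod_of_nonneg`) and block ⑧ at `j, Ts` feed ✓`jensenGapMW_eq_integral_variance` (`q = ∫₀¹ (1−t)·Var_t dt` pointwise on `window_j`,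
  continuity in `t`); JVARᵘ-H gives `(w′, k′)`; the presentation of `q` is `(c′, a′, w′, k′) := (0, 0, w′∕2, k′∕2)` by ✓`…JensenGapTools.abs_fourPoint_le_of_eq_integral`.

HONEST FRAMING: an implication over a hypothesis letter; JVARᵘ-H (the analytic heart: second-order clustering of the m-step small-field fibre laws — what a
Brascamp–Lieb bound ∕ the fluctuation cluster expansion would supply, [Balaban1987RG1] §2, [Balaban1985UV3] (41)–(47)) is NOT proved and is exactly as open as JENᵘ-H;
JENᵘ-H is proved ONLY from JVARᵘ-H; LINᵘ-H, O1ᵘ-H v2, S1aᴴ, crux 20520, `YM3TorusSU2` are NOT proved; registry `Lines/semiclassical_s2beta.lean` v11.4 (★★OWNER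
RULING №36) and `Lines/runpair_organ.lean` untouched, nothing here is registered; rung R3 = SU(2) YM₃ on T³ — NOT d = 4, NOT infinite volume, NOT a mass gap, NOT
Clay; the Yang–Mills mass gap is NOT proved by any of this.  Credit: w3 g23 (single-step knit + E2E pattern ✓`…OrganTangentJensenE2EV26`), w5 g22 ((L16)–(L20)),
LEAD w3 g25 (the cut and the JENᵘ-H text).
-/

set_option autoImplicit false

noncomputable section

namespace Summit.QuantumFields.YangMills.Theorems.FluctuationComparisonRegPrIntLOrganTangentJensenHOfJvarHV21

open MeasureTheory ProbabilityTheory Filter Topology Set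
open scoped ENNReal
open Literature.MathematicalPhysics.QuantumFieldTheory.Balaban1983to89 T3ContinuumYM3Torus T3NestedUnitLaws
  T3UnitLawDensityEML T4Continuum BalabanUVClass T3UnitScaleTilt T3LevelShift T3TiltDescent
open T4CubeChartExp (expPt)
open Summit.QuantumFields.YangMills.Theorems.OrganTangentFibreMeanToolsAnyCut (measurable_sfCutRamp sfCutRamp_nonneg)
open Summit.QuantumFields.YangMills.Theorems.OrganTangentJensenGapTools (abs_fourPoint_le_of_eq_integral)
open Summit.QuantumFields.YangMills.Theorems.FluctuationComparisonRegPrIntLOrganTangentJensenGapKnitMW (jensenGapMW_eq_integral_variance)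
open Summit.QuantumFields.YangMills.Theorems.FluctuationComparisonRegPrIntLOrganTangentJensenHOfJvarH (abs_fourPoint_of_bracket abs_fourPoint_to_bracket)
open Summit.QuantumFields.YangMills.Theorems.FluctuationComparisonRegPrIntLOrganTangentAPackageDescendTo (exists_height_regularSmallFieldDisintegration_descendTo)
open Summit.QuantumFields.YangMills.Theorems.FluctuationComparisonRegPrIntLOrganTangentTowerCutIterate (towerCut_iterate)
open Summit.QuantumFields.YangMills.Theorems.FluctuationComparisonRegPrIntLOrganTangentMultiWindowWeight (exists_height_multiWindowWeight)

/-- ★★ **JENᵘ-H v18.1 ⟸ JVARᵘ-H v18.1, EVERY FAMILY** — the `49∕50` (β)-window edition of ✓p805394 `…JensenHOfJvarH.jensenH_of_jvarH` (same proof; the (β) conjuncts are never read; conclusion = LEAD w3 g25's JENᵘ-H′ `g25/JENuH.v181.text.w3g25.txt` ws16 88c18c312601d06f = the `hJ` binder of `…TaylorCutHV21.oneStepTransportUH_of_tangentH_jensenH`; hypothesis JVARᵘ-H′ = `g19/JVARuH.v181.text.px5g19.txt`). See the module docstring. [cite: Balaban1987RG1, §2 p.264 and Thm 1 (0.22)-(0.30)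 pp.256-258; Balaban1985UV3, (41)-(47) pp.266-267; Balaban1985Averaging, (10)-(13) p.19] -/
theorem jensenH_of_jvarH
    (hJV : ∃ γ₁ : ℝ, 0 < γ₁ ∧ ∀ (F : T3Family) (γ : ℝ), 0 < γ → γ ≤ γ₁ → ∀ (b₀ p₀ : ℝ) (j₀ : ℕ) (prm : ℕ → ClassParams) (η : ℕ → ℝ) (rA : ℝ) (Bρ : ℕ → ℝ), 0 < b₀ → 0 < p₀ → AdmissibleClassParams F γ b₀ p₀ prm → (∀ j, 0 ≤ η j) → Summable η → Summable (fun i => ∑' k, η (k + i)) → Tendsto (fun j => (∑' k, η (k + j)) * ((1 + 2 * ((F.L : ℝ) ^ j / γ) * (Fintype.card (Plaq (F.P j) 0) : ℝ)) * (Fintype.card (PBond (F.P j) 0) : ℝ) ^ 2)) atTop (𝓝 0) → 0 < rA → ∃ κ₀ : ℝ, 0 < κ₀ ∧ ∀ (κ : ℝ), 0 < κ → κ ≤ κ₀ → ∃ (θ r C w₀ : ℝ) (δ : ℕ → ℝ) (j₁ : ℕ), 0 < θ ∧ 0 < r ∧ 0 ≤ C ∧ 0 < w₀ ∧ (∀ j,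 0 ≤ δ j) ∧ Summable δ ∧ Summable (fun i => ∑' k, δ (k + i)) ∧ Tendsto (fun j => (∑' k, δ (k + j)) * ((1 + 2 * ((F.L : ℝ) ^ j / γ) * (Fintype.card (Plaq (F.P j) 0) : ℝ)) * (Fintype.card (PBond (F.P j) 0) : ℝ) ^ 2)) atTop (𝓝 0) ∧ j₀ ≤ j₁ ∧ ∀ (ν : ℕ → (j : ℕ) → MeasureTheory.Measure (GaugeField (F.P j) 0 ↥(Matrix.specialUnitaryGroup (Fin 2) ℂ))), (∀ K, ν K K = T4GenFunBounds.gibbsMeasure (F.P K) ((F.scheme ℰp γ).β K)) → (∀ K j, j < K → ν K j = Measure.map (descend F ℰp j) (ν K (j + 1))) → ∀ (K K' : ℕ), K ≤ K' → ∀ (Ts T : ℕ), Ts < T → T ≤ K → ∀ (μ μ' : ((j : ℕ) → MeasureTheory.Measure (GaugeField (F.P j) 0 ↥(Matrix.specialUnitaryGroup (Fin 2) ℂ)))) (ρ ρ' : ((j : ℕ) → GaugeField (F.P j) 0 ↥(Matrix.specialUnitaryGroup (Fin 2) ℂ) → ℝ)), (∀ j : ℕ, Ts ≤ j → j ≤ T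 → μ j = ν K j ∧ μ' j = ν K' j) → (∀ j : ℕ, j < Ts → μ j = Measure.map (descend F ℰp j) ((μ (j + 1)).withDensity (fun U => ENNReal.ofReal ((∏ p : Plaq _ _, max 0 (min 1 ((24 / 25 * (θBal F.L γ b₀ p₀ (j + 1)) - dist1 (GaugeField.plaqHol U p)) / ((24 / 25 - 1 / 2) * (θBal F.L γ b₀ p₀ (j + 1))))))))) ∧ μ' j = Measure.map (descend F ℰp j) ((μ' (j + 1)).withDensity (fun U => ENNReal.ofReal ((∏ p : Plaq _ _, max 0 (min 1 ((24 / 25 * (θBal F.L γ b₀ p₀ (j + 1)) - dist1 (GaugeField.plaqHol U p)) / ((24 / 25 - 1 / 2) * (θBal F.L γ b₀ p₀ (j + 1)))))))))) → (∀ j : ℕ, Ts ≤ j → j < T → μ j = Measure.map (descend F ℰp j) (μ (j + 1)) ∧ μ' j = Measure.map (descend F ℰp j) (μ' (j + 1))) → (∀ j : ℕ, j ≤ T → IsFiniteMeasure (μ j) ∧ IsFiniteMeasure (μ' j)) → (∀ j : ℕ, j₀ ≤ j → j ≤ T → ((∀ U, PlaqSmall (θBal F.L γ b₀ p₀ j)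 U → 0 < ρ j U ∧ 0 < ρ' j U) ∧ μ j = (fieldMeasure _ _ _).withDensity (fun U => ENNReal.ofReal (ρ j U)) ∧ μ' j = (fieldMeasure _ _ _).withDensity (fun U => ENNReal.ofReal (ρ' j U)) ∧ (∃ κ : ℝ, MemAtHeight F ℰp j (prm j) (fun U => Real.exp κ * ρ j U)) ∧ (∃ κ : ℝ, MemAtHeight F ℰp j (prm j) (fun U => Real.exp κ * ρ' j U)) ∧ μ j {U | ¬ PlaqSmall (θBal F.L γ b₀ p₀ j) U} ≤ ENNReal.ofReal (η j) ∧ μ' j {U | ¬ PlaqSmall (θBal F.L γ b₀ p₀ j) U} ≤ ENNReal.ofReal (η j) ∧ (ContinuousOn (ρ j) {U | PlaqSmall (θBal F.L γ b₀ p₀ j) U} ∧ ContinuousOn (ρ' j) {U | PlaqSmall (θBal F.L γ b₀ p₀ j) U}) ∧ ((∀ (U : GaugeField _ _ ↥(Matrix.specialUnitaryGroup (Fin 2) ℂ)), PlaqSmall (49 / 50 * θBal F.L γ b₀ p₀ j) U → ∀ (b b' : PBond _ _) (v v' : Fin 3 → ℝ), ‖v‖ ≤ 1 → ‖v'‖ ≤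 1 → ∃ g : ℂ × ℂ → ℂ, DifferentiableOn ℂ g (Metric.ball (0 : ℂ) (rA * (49 / 50 * θBal F.L γ b₀ p₀ j)) ×ˢ Metric.ball (0 : ℂ) (rA * (49 / 50 * θBal F.L γ b₀ p₀ j))) ∧ (∀ (s t : ℝ) (V Z : GaugeField _ _ ↥(Matrix.specialUnitaryGroup (Fin 2) ℂ)), |s| < rA * (49 / 50 * θBal F.L γ b₀ p₀ j) → |t| < rA * (49 / 50 * θBal F.L γ b₀ p₀ j) → (∀ e, e ≠ b → V e = U e) → V b = U b * expPt (s • v) → (∀ e, e ≠ b' → Z e = V e) → Z b' = V b' * expPt (t • v') → g ((s : ℂ), (t : ℂ)) = (((Real.log (ρ j Z)) : ℝ) : ℂ)) ∧ ∀ z ∈ Metric.ball (0 : ℂ) (rA * (49 / 50 * θBal F.L γ b₀ p₀ j)) ×ˢ Metric.ball (0 : ℂ) (rA * (49 / 50 * θBal F.L γ b₀ p₀ j)), ‖g z - g 0‖ ≤ (Bρ j)) ∧ (∀ (U : GaugeField _ _ ↥(Matrix.specialUnitaryGroup (Fin 2) ℂ)), PlaqSmall (49 / 50 * θBal F.L γ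 b₀ p₀ j) U → ∀ (b b' : PBond _ _) (v v' : Fin 3 → ℝ), ‖v‖ ≤ 1 → ‖v'‖ ≤ 1 → ∃ g : ℂ × ℂ → ℂ, DifferentiableOn ℂ g (Metric.ball (0 : ℂ) (rA * (49 / 50 * θBal F.L γ b₀ p₀ j)) ×ˢ Metric.ball (0 : ℂ) (rA * (49 / 50 * θBal F.L γ b₀ p₀ j))) ∧ (∀ (s t : ℝ) (V Z : GaugeField _ _ ↥(Matrix.specialUnitaryGroup (Fin 2) ℂ)), |s| < rA * (49 / 50 * θBal F.L γ b₀ p₀ j) → |t| < rA * (49 / 50 * θBal F.L γ b₀ p₀ j) → (∀ e, e ≠ b → V e = U e) → V b = U b * expPt (s • v) → (∀ e, e ≠ b' → Z e = V e) → Z b' = V b' * expPt (t • v') → g ((s : ℂ), (t : ℂ)) = (((Real.log (ρ' j Z)) : ℝ) : ℂ)) ∧ ∀ z ∈ Metric.ball (0 : ℂ) (rA * (49 / 50 * θBal F.L γ b₀ p₀ j)) ×ˢ Metric.ball (0 : ℂ) (rA * (49 / 50 * θBal F.L γ b₀ p₀ j)), ‖g z - g 0‖ ≤ (Bρ j)))))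 → ∀ (w : ℝ), 0 ≤ w → w / (((F.L : ℝ) ^ Ts / γ) * θBal F.L γ b₀ p₀ Ts ^ 2) ≤ w₀ → (∃ k : PBond (F.P Ts) 0 → PBond (F.P Ts) 0 → ℝ, (∀ b b', 0 ≤ k b b') ∧ (∀ b, ∑ b', k b b' * Real.exp (κ * (b.src.tdist b'.src : ℝ)) ≤ w) ∧ (∀ (b b' : PBond _ _) (v v' : Fin 3 → ℝ) (U V W Z : GaugeField _ _ ↥(Matrix.specialUnitaryGroup (Fin 2) ℂ)), ‖v‖ ≤ (rA / 2) * (θBal F.L γ b₀ p₀ Ts / 4) → ‖v'‖ ≤ (rA / 2) * (θBal F.L γ b₀ p₀ Ts / 4) → PlaqSmall (θBal F.L γ b₀ p₀ Ts / 4) U → PlaqSmall (θBal F.L γ b₀ p₀ Ts / 4) V → PlaqSmall (θBal F.L γ b₀ p₀ Ts / 4) W → PlaqSmall (θBal F.L γ b₀ p₀ Ts / 4) Z → (∀ e, e ≠ b → V e = U e) → V b = U b * expPt v → (∀ e, e ≠ b' → W e = U e) → W b' = U b' * expPt v' → (∀ e, e ≠ b' → Z e = V e) → Z b' = V b' * expPt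 v' → |(Real.log (ρ Ts Z) - Real.log (ρ' Ts Z)) - (Real.log (ρ Ts V) - Real.log (ρ' Ts V)) - (Real.log (ρ Ts W) - Real.log (ρ' Ts W)) + (Real.log (ρ Ts U) - Real.log (ρ' Ts U))| ≤ k b b' * (‖v‖ / (θBal F.L γ b₀ p₀ Ts / 4)) * (‖v'‖ / (θBal F.L γ b₀ p₀ Ts / 4)))) → ∀ (j : ℕ), j₁ ≤ j → ∀ (hjTs : j + 1 ≤ Ts), ∀ (σ : ProbabilityTheory.Kernel (GaugeField (F.P j) 0 ↥(Matrix.specialUnitaryGroup (Fin 2) ℂ)) (GaugeField (F.P Ts) 0 ↥(Matrix.specialUnitaryGroup (Fin 2) ℂ))), ProbabilityTheory.IsMarkovKernel σ → (Measure.map (descendTo F ℰp j Ts (Nat.le_of_succ_le hjTs)) (fieldMeasure (F.P Ts) 0 ↥(Matrix.specialUnitaryGroup (Fin 2) ℂ))).bind ⇑σ = fieldMeasure (F.P Ts) 0 ↥(Matrix.specialUnitaryGroup (Fin 2) ℂ) → (∀ᵐ V ∂(Measure.map (descendTo F ℰp j Ts (Nat.le_of_succ_le hjTs)) (fieldMeasure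 (F.P Ts) 0 ↥(Matrix.specialUnitaryGroup (Fin 2) ℂ))), ∀ᵐ U ∂(σ V), descendTo F ℰp j Ts (Nat.le_of_succ_le hjTs) U = V) → ∀ (mfun : GaugeField (F.P j) 0 ↥(Matrix.specialUnitaryGroup (Fin 2) ℂ) → ℝ), ContinuousOn mfun {V | PlaqSmall (θBal F.L γ b₀ p₀ j) V} → (∀ᵐ V ∂(fieldMeasure (F.P j) 0 ↥(Matrix.specialUnitaryGroup (Fin 2) ℂ)), PlaqSmall (θBal F.L γ b₀ p₀ j) V → MeasureTheory.Integrable (fun U => (∏ i ∈ Finset.range (Ts - j), (if h : j + 1 + i ≤ Ts then (∏ p : Plaq (F.P (j + 1 + i)) 0, max 0 (min 1 ((24 / 25 * θBal F.L γ b₀ p₀ (j + 1 + i) - dist1 (GaugeField.plaqHol (descendTo F ℰp (j + 1 + i) Ts h U) p)) / ((24 / 25 - 1 / 2) * θBal F.L γ b₀ p₀ (j + 1 + i))))) else 1)) * (Real.log (ρ Ts U) - Real.log (ρ' Ts U)) * ρ' Ts U) (σ V) ∧ mfun V = (∫ U, (∏ i ∈ Finset.range (Ts - j), (if h : j + 1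 + i ≤ Ts then (∏ p : Plaq (F.P (j + 1 + i)) 0, max 0 (min 1 ((24 / 25 * θBal F.L γ b₀ p₀ (j + 1 + i) - dist1 (GaugeField.plaqHol (descendTo F ℰp (j + 1 + i) Ts h U) p)) / ((24 / 25 - 1 / 2) * θBal F.L γ b₀ p₀ (j + 1 + i))))) else 1)) * (Real.log (ρ Ts U) - Real.log (ρ' Ts U)) * ρ' Ts U ∂(σ V)) / (∫ U, (∏ i ∈ Finset.range (Ts - j), (if h : j + 1 + i ≤ Ts then (∏ p : Plaq (F.P (j + 1 + i)) 0, max 0 (min 1 ((24 / 25 * θBal F.L γ b₀ p₀ (j + 1 + i) - dist1 (GaugeField.plaqHol (descendTo F ℰp (j + 1 + i) Ts h U) p)) / ((24 / 25 - 1 / 2) * θBal F.L γ b₀ p₀ (j + 1 + i))))) else 1)) * ρ' Ts U ∂(σ V))) → ∀ (σ₀ : ProbabilityTheory.Kernel (GaugeField (F.P j) 0 ↥(Matrix.specialUnitaryGroup (Fin 2) ℂ)) (GaugeField (F.P Ts) 0 ↥(Matrix.specialUnitaryGroup (Fin 2) ℂ))) (lam : GaugeField (F.P j) 0 ↥(Matrix.specialUnitaryGroup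 (Fin 2) ℂ) → MeasureTheory.Measure (GaugeField (F.P Ts) 0 ↥(Matrix.specialUnitaryGroup (Fin 2) ℂ))), ProbabilityTheory.IsMarkovKernel σ₀ → (Measure.map (descendTo F ℰp j Ts (Nat.le_of_succ_le hjTs)) (fieldMeasure (F.P Ts) 0 ↥(Matrix.specialUnitaryGroup (Fin 2) ℂ))).bind ⇑σ₀ = fieldMeasure (F.P Ts) 0 ↥(Matrix.specialUnitaryGroup (Fin 2) ℂ) → (∀ᵐ V ∂(Measure.map (descendTo F ℰp j Ts (Nat.le_of_succ_le hjTs)) (fieldMeasure (F.P Ts) 0 ↥(Matrix.specialUnitaryGroup (Fin 2) ℂ))), ∀ᵐ U ∂(σ₀ V), descendTo F ℰp j Ts (Nat.le_of_succ_le hjTs) U = V) → (∀ V, MeasureTheory.IsFiniteMeasure (lam V)) → (∀ f : GaugeField (F.P Ts) 0 ↥(Matrix.specialUnitaryGroup (Fin 2) ℂ) → ℝ, Continuous f → (∀ U, f U ≠ 0 → ∀ (n : ℕ) (hjn : j + 1 ≤ n) (hnK : n ≤ Ts), PlaqSmall (24 / 25 * θBal F.L γ b₀ p₀ n) (descendTo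 F ℰp n Ts hnK U)) → ContinuousOn (fun V => ∫ U, f U ∂(lam V)) {V | PlaqSmall (θBal F.L γ b₀ p₀ j) V}) → (∀ V, PlaqSmall (θBal F.L γ b₀ p₀ j) V → 0 < lam V {U | ∀ (n : ℕ) (hjn : j + 1 ≤ n) (hnK : n ≤ Ts), PlaqSmall (24 / 25 * θBal F.L γ b₀ p₀ n) (descendTo F ℰp n Ts hnK U)}) → (∃ c : GaugeField (F.P j) 0 ↥(Matrix.specialUnitaryGroup (Fin 2) ℂ) → ℝ, ∀ f : GaugeField (F.P Ts) 0 ↥(Matrix.specialUnitaryGroup (Fin 2) ℂ) → ℝ, Continuous f → (∀ U, ¬ (∀ (n : ℕ) (hjn : j + 1 ≤ n) (hnK : n ≤ Ts), PlaqSmall (24 / 25 * θBal F.L γ b₀ p₀ n) (descendTo F ℰp n Ts hnK U)) → f U = 0) → ∀ᵐ V ∂(Measure.map (descendTo F ℰp j Ts (Nat.le_of_succ_le hjTs)) (fieldMeasure (F.P Ts) 0 ↥(Matrix.specialUnitaryGroup (Fin 2) ℂ))), PlaqSmall (θBal F.L γ b₀ p₀ j) V → 0 < c V ∧ ∫ U,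 f U ∂(σ₀ V) = c V * ∫ U, f U ∂(lam V)) → ∃ w' : ℝ, 0 ≤ w' ∧ θ * (w' / (((F.L : ℝ) ^ j / γ) * θBal F.L γ b₀ p₀ j ^ 2)) ≤ C * (w / (((F.L : ℝ) ^ Ts / γ) * θBal F.L γ b₀ p₀ Ts ^ 2)) * (w / (((F.L : ℝ) ^ Ts / γ) * θBal F.L γ b₀ p₀ Ts ^ 2)) + δ j ∧ ∃ k' : PBond (F.P j) 0 → PBond (F.P j) 0 → ℝ, (∀ b b', 0 ≤ k' b b') ∧ (∀ b, ∑ b', k' b b' * Real.exp (κ * (b.src.tdist b'.src : ℝ)) ≤ w') ∧ ∀ t ∈ Set.Icc (0 : ℝ) 1, (∀ (b b' : PBond _ _) (v v' : Fin 3 → ℝ) (U V W Z : GaugeField _ _ ↥(Matrix.specialUnitaryGroup (Fin 2) ℂ)), ‖v‖ ≤ r * (θBal F.L γ b₀ p₀ j / 4) → ‖v'‖ ≤ r * (θBal F.L γ b₀ p₀ j / 4) → PlaqSmall (θBal F.L γ b₀ p₀ j / 4) U → PlaqSmall (θBal F.L γ b₀ p₀ j / 4) V → PlaqSmall (θBal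 F.L γ b₀ p₀ j / 4) W → PlaqSmall (θBal F.L γ b₀ p₀ j / 4) Z → (∀ e, e ≠ b → V e = U e) → V b = U b * expPt v → (∀ e, e ≠ b' → W e = U e) → W b' = U b' * expPt v' → (∀ e, e ≠ b' → Z e = V e) → Z b' = V b' * expPt v' → |ProbabilityTheory.variance (fun U => Real.log (ρ Ts U) - Real.log (ρ' Ts U)) (((lam Z).withDensity (fun U => ENNReal.ofReal ((∏ i ∈ Finset.range (Ts - j), (if h : j + 1 + i ≤ Ts then (∏ p : Plaq (F.P (j + 1 + i)) 0, max 0 (min 1 ((24 / 25 * θBal F.L γ b₀ p₀ (j + 1 + i) - dist1 (GaugeField.plaqHol (descendTo F ℰp (j + 1 + i) Ts h U) p)) / ((24 / 25 - 1 / 2) * θBal F.L γ b₀ p₀ (j + 1 + i))))) else 1)) * ρ' Ts U))).tilted (fun U => t * (Real.log (ρ Ts U) - Real.log (ρ' Ts U)))) - ProbabilityTheory.variance (fun U => Real.log (ρ Ts U) - Real.log (ρ' Ts U)) (((lam V).withDensity (fun U => ENNReal.ofReal ((∏ i ∈ Finset.range (Ts - j), (if h : j + 1 + i ≤ Ts then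 (∏ p : Plaq (F.P (j + 1 + i)) 0, max 0 (min 1 ((24 / 25 * θBal F.L γ b₀ p₀ (j + 1 + i) - dist1 (GaugeField.plaqHol (descendTo F ℰp (j + 1 + i) Ts h U) p)) / ((24 / 25 - 1 / 2) * θBal F.L γ b₀ p₀ (j + 1 + i))))) else 1)) * ρ' Ts U))).tilted (fun U => t * (Real.log (ρ Ts U) - Real.log (ρ' Ts U)))) - ProbabilityTheory.variance (fun U => Real.log (ρ Ts U) - Real.log (ρ' Ts U)) (((lam W).withDensity (fun U => ENNReal.ofReal ((∏ i ∈ Finset.range (Ts - j), (if h : j + 1 + i ≤ Ts then (∏ p : Plaq (F.P (j + 1 + i)) 0, max 0 (min 1 ((24 / 25 * θBal F.L γ b₀ p₀ (j + 1 + i) - dist1 (GaugeField.plaqHol (descendTo F ℰp (j + 1 + i) Ts h U) p)) / ((24 / 25 - 1 / 2) * θBal F.L γ b₀ p₀ (j + 1 + i))))) else 1)) * ρ' Ts U))).tilted (fun U => t * (Real.log (ρ Ts U) - Real.log (ρ' Ts U)))) + ProbabilityTheory.variance (fun U => Real.log (ρ Ts U) - Real.log (ρ' Ts U)) (((lam U).withDensity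 (fun U => ENNReal.ofReal ((∏ i ∈ Finset.range (Ts - j), (if h : j + 1 + i ≤ Ts then (∏ p : Plaq (F.P (j + 1 + i)) 0, max 0 (min 1 ((24 / 25 * θBal F.L γ b₀ p₀ (j + 1 + i) - dist1 (GaugeField.plaqHol (descendTo F ℰp (j + 1 + i) Ts h U) p)) / ((24 / 25 - 1 / 2) * θBal F.L γ b₀ p₀ (j + 1 + i))))) else 1)) * ρ' Ts U))).tilted (fun U => t * (Real.log (ρ Ts U) - Real.log (ρ' Ts U))))| ≤ k' b b' * (‖v‖ / (θBal F.L γ b₀ p₀ j / 4)) * (‖v'‖ / (θBal F.L γ b₀ p₀ j / 4)))) :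
    ∃ γ₁ : ℝ, 0 < γ₁ ∧ ∀ (F : T3Family) (γ : ℝ), 0 < γ → γ ≤ γ₁ → ∀ (b₀ p₀ : ℝ) (j₀ : ℕ) (prm : ℕ → ClassParams) (η : ℕ → ℝ) (rA : ℝ) (Bρ : ℕ → ℝ), 0 < b₀ → 0 < p₀ → AdmissibleClassParams F γ b₀ p₀ prm → (∀ j, 0 ≤ η j) → Summable η → Summable (fun i => ∑' k, η (k + i)) → Tendsto (fun j => (∑' k, η (k + j)) * ((1 + 2 * ((F.L : ℝ) ^ j / γ) * (Fintype.card (Plaq (F.P j) 0) : ℝ)) * (Fintype.card (PBond (F.P j) 0) : ℝ) ^ 2)) atTop (𝓝 0) → 0 < rA → ∃ κ₀ : ℝ, 0 < κ₀ ∧ ∀ (κ : ℝ), 0 < κ → κ ≤ κ₀ → ∃ (θ r C w₀ : ℝ) (δ : ℕ → ℝ) (j₁ : ℕ), 0 < θ ∧ 0 < r ∧ 0 ≤ C ∧ 0 < w₀ ∧ (∀ j, 0 ≤ δ j) ∧ Summable δ ∧ Summable (fun i => ∑' k, δ (k + i)) ∧ Tendsto (fun j => (∑' k, δ (k + j)) *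 ((1 + 2 * ((F.L : ℝ) ^ j / γ) * (Fintype.card (Plaq (F.P j) 0) : ℝ)) * (Fintype.card (PBond (F.P j) 0) : ℝ) ^ 2)) atTop (𝓝 0) ∧ j₀ ≤ j₁ ∧ ∀ (ν : ℕ → (j : ℕ) → MeasureTheory.Measure (GaugeField (F.P j) 0 ↥(Matrix.specialUnitaryGroup (Fin 2) ℂ))), (∀ K, ν K K = T4GenFunBounds.gibbsMeasure (F.P K) ((F.scheme ℰp γ).β K)) → (∀ K j, j < K → ν K j = Measure.map (descend F ℰp j) (ν K (j + 1))) → ∀ (K K' : ℕ), K ≤ K' → ∀ (Ts T : ℕ), Ts < T → T ≤ K → ∀ (μ μ' : ((j : ℕ) → MeasureTheory.Measure (GaugeField (F.P j) 0 ↥(Matrix.specialUnitaryGroup (Fin 2) ℂ)))) (ρ ρ' : ((j : ℕ) → GaugeField (F.P j) 0 ↥(Matrix.specialUnitaryGroup (Fin 2) ℂ) → ℝ)), (∀ j : ℕ, Ts ≤ j → j ≤ T → μ j = ν K j ∧ μ' j = ν K' j) → (∀ j : ℕ, j < Ts → μ j = Measure.map (descend F ℰp j) ((μ (j + 1)).withDensity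 (fun U => ENNReal.ofReal ((∏ p : Plaq _ _, max 0 (min 1 ((24 / 25 * (θBal F.L γ b₀ p₀ (j + 1)) - dist1 (GaugeField.plaqHol U p)) / ((24 / 25 - 1 / 2) * (θBal F.L γ b₀ p₀ (j + 1))))))))) ∧ μ' j = Measure.map (descend F ℰp j) ((μ' (j + 1)).withDensity (fun U => ENNReal.ofReal ((∏ p : Plaq _ _, max 0 (min 1 ((24 / 25 * (θBal F.L γ b₀ p₀ (j + 1)) - dist1 (GaugeField.plaqHol U p)) / ((24 / 25 - 1 / 2) * (θBal F.L γ b₀ p₀ (j + 1)))))))))) → (∀ j : ℕ, Ts ≤ j → j < T → μ j = Measure.map (descend F ℰp j) (μ (j + 1)) ∧ μ' j = Measure.map (descend F ℰp j) (μ' (j + 1))) → (∀ j : ℕ, j ≤ T → IsFiniteMeasure (μ j) ∧ IsFiniteMeasure (μ' j)) → (∀ j : ℕ, j₀ ≤ j → j ≤ T → ((∀ U, PlaqSmall (θBal F.L γ b₀ p₀ j) U → 0 < ρ j U ∧ 0 < ρ' j U) ∧ μ j = (fieldMeasure _ _ _).withDensity (fun U => ENNReal.ofReal (ρ j U)) ∧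 μ' j = (fieldMeasure _ _ _).withDensity (fun U => ENNReal.ofReal (ρ' j U)) ∧ (∃ κ : ℝ, MemAtHeight F ℰp j (prm j) (fun U => Real.exp κ * ρ j U)) ∧ (∃ κ : ℝ, MemAtHeight F ℰp j (prm j) (fun U => Real.exp κ * ρ' j U)) ∧ μ j {U | ¬ PlaqSmall (θBal F.L γ b₀ p₀ j) U} ≤ ENNReal.ofReal (η j) ∧ μ' j {U | ¬ PlaqSmall (θBal F.L γ b₀ p₀ j) U} ≤ ENNReal.ofReal (η j) ∧ (ContinuousOn (ρ j) {U | PlaqSmall (θBal F.L γ b₀ p₀ j) U} ∧ ContinuousOn (ρ' j) {U | PlaqSmall (θBal F.L γ b₀ p₀ j) U}) ∧ ((∀ (U : GaugeField _ _ ↥(Matrix.specialUnitaryGroup (Fin 2) ℂ)), PlaqSmall (49 / 50 * θBal F.L γ b₀ p₀ j) U → ∀ (b b' : PBond _ _) (v v' : Fin 3 → ℝ), ‖v‖ ≤ 1 → ‖v'‖ ≤ 1 → ∃ g : ℂ × ℂ → ℂ, DifferentiableOn ℂ g (Metric.ball (0 : ℂ) (rA * (49 / 50 * θBal F.L γ b₀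 p₀ j)) ×ˢ Metric.ball (0 : ℂ) (rA * (49 / 50 * θBal F.L γ b₀ p₀ j))) ∧ (∀ (s t : ℝ) (V Z : GaugeField _ _ ↥(Matrix.specialUnitaryGroup (Fin 2) ℂ)), |s| < rA * (49 / 50 * θBal F.L γ b₀ p₀ j) → |t| < rA * (49 / 50 * θBal F.L γ b₀ p₀ j) → (∀ e, e ≠ b → V e = U e) → V b = U b * expPt (s • v) → (∀ e, e ≠ b' → Z e = V e) → Z b' = V b' * expPt (t • v') → g ((s : ℂ), (t : ℂ)) = (((Real.log (ρ j Z)) : ℝ) : ℂ)) ∧ ∀ z ∈ Metric.ball (0 : ℂ) (rA * (49 / 50 * θBal F.L γ b₀ p₀ j)) ×ˢ Metric.ball (0 : ℂ) (rA * (49 / 50 * θBal F.L γ b₀ p₀ j)), ‖g z - g 0‖ ≤ (Bρ j)) ∧ (∀ (U : GaugeField _ _ ↥(Matrix.specialUnitaryGroup (Fin 2) ℂ)), PlaqSmall (49 / 50 * θBal F.L γ b₀ p₀ j) U → ∀ (b b' : PBond _ _) (v v' : Fin 3 → ℝ), ‖v‖ ≤ 1 → ‖v'‖ ≤ 1 →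 ∃ g : ℂ × ℂ → ℂ, DifferentiableOn ℂ g (Metric.ball (0 : ℂ) (rA * (49 / 50 * θBal F.L γ b₀ p₀ j)) ×ˢ Metric.ball (0 : ℂ) (rA * (49 / 50 * θBal F.L γ b₀ p₀ j))) ∧ (∀ (s t : ℝ) (V Z : GaugeField _ _ ↥(Matrix.specialUnitaryGroup (Fin 2) ℂ)), |s| < rA * (49 / 50 * θBal F.L γ b₀ p₀ j) → |t| < rA * (49 / 50 * θBal F.L γ b₀ p₀ j) → (∀ e, e ≠ b → V e = U e) → V b = U b * expPt (s • v) → (∀ e, e ≠ b' → Z e = V e) → Z b' = V b' * expPt (t • v') → g ((s : ℂ), (t : ℂ)) = (((Real.log (ρ' j Z)) : ℝ) : ℂ)) ∧ ∀ z ∈ Metric.ball (0 : ℂ) (rA * (49 / 50 * θBal F.L γ b₀ p₀ j)) ×ˢ Metric.ball (0 : ℂ) (rA * (49 / 50 * θBal F.L γ b₀ p₀ j)), ‖g z - g 0‖ ≤ (Bρ j))))) → ∀ (w : ℝ), 0 ≤ w → w / (((F.L : ℝ) ^ Ts / γ) * θBal F.L γ b₀ p₀ Ts ^ 2) ≤ w₀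 → (∃ k : PBond (F.P Ts) 0 → PBond (F.P Ts) 0 → ℝ, (∀ b b', 0 ≤ k b b') ∧ (∀ b, ∑ b', k b b' * Real.exp (κ * (b.src.tdist b'.src : ℝ)) ≤ w) ∧ (∀ (b b' : PBond _ _) (v v' : Fin 3 → ℝ) (U V W Z : GaugeField _ _ ↥(Matrix.specialUnitaryGroup (Fin 2) ℂ)), ‖v‖ ≤ (rA / 2) * (θBal F.L γ b₀ p₀ Ts / 4) → ‖v'‖ ≤ (rA / 2) * (θBal F.L γ b₀ p₀ Ts / 4) → PlaqSmall (θBal F.L γ b₀ p₀ Ts / 4) U → PlaqSmall (θBal F.L γ b₀ p₀ Ts / 4) V → PlaqSmall (θBal F.L γ b₀ p₀ Ts / 4) W → PlaqSmall (θBal F.L γ b₀ p₀ Ts / 4) Z → (∀ e, e ≠ b → V e = U e) → V b = U b * expPt v → (∀ e, e ≠ b' → W e = U e) → W b' = U b' * expPt v' → (∀ e, e ≠ b' → Z e = V e) → Z b' = V b' * expPt v' → |(Real.log (ρ Ts Z) - Real.log (ρ' Ts Z)) - (Real.log (ρ Ts V) - Real.log (ρ' Ts V)) - (Real.log (ρ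 Ts W) - Real.log (ρ' Ts W)) + (Real.log (ρ Ts U) - Real.log (ρ' Ts U))| ≤ k b b' * (‖v‖ / (θBal F.L γ b₀ p₀ Ts / 4)) * (‖v'‖ / (θBal F.L γ b₀ p₀ Ts / 4)))) → ∀ (j : ℕ), j₁ ≤ j → ∀ (hjTs : j + 1 ≤ Ts), ∀ (σ : ProbabilityTheory.Kernel (GaugeField (F.P j) 0 ↥(Matrix.specialUnitaryGroup (Fin 2) ℂ)) (GaugeField (F.P Ts) 0 ↥(Matrix.specialUnitaryGroup (Fin 2) ℂ))), ProbabilityTheory.IsMarkovKernel σ → (Measure.map (descendTo F ℰp j Ts (Nat.le_of_succ_le hjTs)) (fieldMeasure (F.P Ts) 0 ↥(Matrix.specialUnitaryGroup (Fin 2) ℂ))).bind ⇑σ = fieldMeasure (F.P Ts) 0 ↥(Matrix.specialUnitaryGroup (Fin 2) ℂ) → (∀ᵐ V ∂(Measure.map (descendTo F ℰp j Ts (Nat.le_of_succ_le hjTs)) (fieldMeasure (F.P Ts) 0 ↥(Matrix.specialUnitaryGroup (Fin 2) ℂ))), ∀ᵐ U ∂(σ V), descendTo F ℰp j Ts (Nat.le_of_succ_le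 hjTs) U = V) → ∀ (mfun : GaugeField (F.P j) 0 ↥(Matrix.specialUnitaryGroup (Fin 2) ℂ) → ℝ), ContinuousOn mfun {V | PlaqSmall (θBal F.L γ b₀ p₀ j) V} → (∀ᵐ V ∂(fieldMeasure (F.P j) 0 ↥(Matrix.specialUnitaryGroup (Fin 2) ℂ)), PlaqSmall (θBal F.L γ b₀ p₀ j) V → MeasureTheory.Integrable (fun U => (∏ i ∈ Finset.range (Ts - j), (if h : j + 1 + i ≤ Ts then (∏ p : Plaq (F.P (j + 1 + i)) 0, max 0 (min 1 ((24 / 25 * θBal F.L γ b₀ p₀ (j + 1 + i) - dist1 (GaugeField.plaqHol (descendTo F ℰp (j + 1 + i) Ts h U) p)) / ((24 / 25 - 1 / 2) * θBal F.L γ b₀ p₀ (j + 1 + i))))) else 1)) * (Real.log (ρ Ts U) - Real.log (ρ' Ts U)) * ρ' Ts U) (σ V) ∧ mfun V = (∫ U, (∏ i ∈ Finset.range (Ts - j), (if h : j + 1 + i ≤ Ts then (∏ p : Plaq (F.P (j + 1 + i)) 0, max 0 (min 1 ((24 / 25 * θBal F.L γ b₀ p₀ (j + 1 + i) - dist1 (GaugeField.plaqHol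 (descendTo F ℰp (j + 1 + i) Ts h U) p)) / ((24 / 25 - 1 / 2) * θBal F.L γ b₀ p₀ (j + 1 + i))))) else 1)) * (Real.log (ρ Ts U) - Real.log (ρ' Ts U)) * ρ' Ts U ∂(σ V)) / (∫ U, (∏ i ∈ Finset.range (Ts - j), (if h : j + 1 + i ≤ Ts then (∏ p : Plaq (F.P (j + 1 + i)) 0, max 0 (min 1 ((24 / 25 * θBal F.L γ b₀ p₀ (j + 1 + i) - dist1 (GaugeField.plaqHol (descendTo F ℰp (j + 1 + i) Ts h U) p)) / ((24 / 25 - 1 / 2) * θBal F.L γ b₀ p₀ (j + 1 + i))))) else 1)) * ρ' Ts U ∂(σ V))) → ∃ (c' : Plaq (F.P j) 0 → ℝ) (a' w' : ℝ), 0 ≤ a' ∧ 0 ≤ w' ∧ a' + θ * (w' / (((F.L : ℝ) ^ j / γ) * θBal F.L γ b₀ p₀ j ^ 2)) ≤ C * (w / (((F.L : ℝ) ^ Ts / γ) * θBal F.L γ b₀ p₀ Ts ^ 2)) * (w / (((F.L : ℝ) ^ Ts / γ) * θBal F.L γ b₀ p₀ Ts ^ 2)) + δ j ∧ (∀ p,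 |c' p| ≤ a') ∧ ∃ k' : PBond (F.P j) 0 → PBond (F.P j) 0 → ℝ, (∀ b b', 0 ≤ k' b b') ∧ (∀ b, ∑ b', k' b b' * Real.exp (κ * (b.src.tdist b'.src : ℝ)) ≤ w') ∧ (∀ (b b' : PBond _ _) (v v' : Fin 3 → ℝ) (U V W Z : GaugeField _ _ ↥(Matrix.specialUnitaryGroup (Fin 2) ℂ)), ‖v‖ ≤ r * (θBal F.L γ b₀ p₀ j / 4) → ‖v'‖ ≤ r * (θBal F.L γ b₀ p₀ j / 4) → PlaqSmall (θBal F.L γ b₀ p₀ j / 4) U → PlaqSmall (θBal F.L γ b₀ p₀ j / 4) V → PlaqSmall (θBal F.L γ b₀ p₀ j / 4) W → PlaqSmall (θBal F.L γ b₀ p₀ j / 4) Z → (∀ e, e ≠ b → V e = U e) → V b = U b * expPt v → (∀ e, e ≠ b' → W e = U e) → W b' = U b' * expPt v' → (∀ e, e ≠ b' → Z e = V e) → Z b' = V b' * expPt v' → |(Real.log (ρ j Z) - Real.log (ρ' j Z) - mfun Z - ((F.L : ℝ) ^ j / γ) * ∑ p, c' p * (1 - reTr (GaugeField.plaqHol Z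 p))) - (Real.log (ρ j V) - Real.log (ρ' j V) - mfun V - ((F.L : ℝ) ^ j / γ) * ∑ p, c' p * (1 - reTr (GaugeField.plaqHol V p))) - (Real.log (ρ j W) - Real.log (ρ' j W) - mfun W - ((F.L : ℝ) ^ j / γ) * ∑ p, c' p * (1 - reTr (GaugeField.plaqHol W p))) + (Real.log (ρ j U) - Real.log (ρ' j U) - mfun U - ((F.L : ℝ) ^ j / γ) * ∑ p, c' p * (1 - reTr (GaugeField.plaqHol U p)))| ≤ k' b b' * (‖v‖ / (θBal F.L γ b₀ p₀ j / 4)) * (‖v'‖ / (θBal F.L γ b₀ p₀ j / 4))) := by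
  classical
  obtain ⟨γ₁, hγ₁, hJV⟩ := hJV
  refine ⟨min γ₁ 1, lt_min hγ₁ one_pos, ?_⟩
  intro F γ hγ hγle b₀ p₀ j₀ prm η rA Bρ hb₀ hp₀ hadm hη0 hηs hηss hηt hrA
  have hγ1 : γ ≤ 1 := hγle.trans (min_le_right _ _)
  obtain ⟨κ₀, hκ₀, hJV⟩ := hJV F γ hγ (hγle.trans (min_le_left _ _)) b₀ p₀ j₀ prm η rA Bρ hb₀ hp₀ hadm hη0 hηs hηss hηt hrA
  refine ⟨κ₀, hκ₀, ?_⟩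
  intro κ hκ hκle
  obtain ⟨θ, r, C, w₀, δ, j₁, hθ, hr, hC, hw₀, hδ0, hδs, hδss, hδt, hj₀₁, hJV⟩ := hJV κ hκ hκle
  obtain ⟨jA, hjA⟩ := exists_height_regularSmallFieldDisintegration_descendTo F γ b₀ p₀ hγ hγ1 hb₀ hp₀
  obtain ⟨jχ, hjχ⟩ := exists_height_multiWindowWeight F γ b₀ p₀ hγ hγ1 hb₀
  refine ⟨θ, r, C, w₀, δ, max j₁ (max jA jχ), hθ, hr, hC, hw₀, hδ0, hδs, hδss, hδt, hj₀₁.trans (le_max_left _ _), ?_⟩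
  intro ν hG hCν K K' hKK' Ts T hTs hTK μ μ' ρ ρ' hanch hcut hcons hfin hwin w hw0 hwle hseed j hj hjTs σ hσM hσb hσf mfun hmc hmae
  have hj₁ : j₁ ≤ j := (le_max_left _ _).trans hj
  have hjA' : jA ≤ j := ((le_max_left _ _).trans (le_max_right _ _)).trans hj
  have hjχ' : jχ ≤ j := ((le_max_right _ _).trans (le_max_right _ _)).trans hj
  obtain ⟨σ₀, lam, hσ₀M, hbind₀, hfib₀, hlam, hA1, hA2, hA3⟩ := hjA j hjA' Ts hjTs
  obtain ⟨hχc, hχ0, hχsupp, hχpos⟩ := hjχ j hjχ' Ts hjTs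
  -- JVARᵘ-H at this data
  obtain ⟨w', hw'0, hbd, k', hk'0, hrow, h4⟩ := hJV ν hG hCν K K' hKK' Ts T hTs hTK μ μ' ρ ρ' hanch hcut hcons hfin hwin w hw0 hwle hseed j hj₁ hjTs
    σ hσM hσb hσf mfun hmc hmae σ₀ lam hσ₀M hbind₀ hfib₀ hlam hA1 hA2 hA3
  -- the frame at heights `j` and `Ts`
  have hj₀ : j₀ ≤ j := hj₀₁.trans hj₁
  have hTs₀ : j₀ ≤ Ts := by omega
  have hTsT : Ts ≤ T := hTs.le
  have hjT : j ≤ T := by omega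
  have hwT := hwin Ts hTs₀ hTsT
  have hwj := hwin j hj₀ hjT
  have hθTs : 0 < θBal F.L γ b₀ p₀ Ts := T3MinimiserStabilityReduction.θBal_pos F.hL.2.le hγ hγ1 hb₀ p₀ Ts
  have hθj : 0 < θBal F.L γ b₀ p₀ j := T3MinimiserStabilityReduction.θBal_pos F.hL.2.le hγ hγ1 hb₀ p₀ j
  -- measurability from membership modulo constants (R-n4)
  have hmeas : ∀ (n : ℕ) (g : GaugeField (F.P n) 0 ↥(Matrix.specialUnitaryGroup (Fin 2) ℂ) → ℝ),
      (∃ κ' : ℝ, MemAtHeight F ℰp n (prm n) (fun U => Real.exp κ' * g U)) → Measurable g := by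
    intro n g ⟨κ', hκ'⟩
    have h1 : Measurable (fun U => Real.exp κ' * g U) := hκ'.measurable
    have h2 : g = fun U => (Real.exp κ')⁻¹ * (Real.exp κ' * g U) := by
      funext U; rw [← mul_assoc, inv_mul_cancel₀ (Real.exp_pos κ').ne', one_mul]
    rw [h2]; exact h1.const_mul _
  have hρTm : Measurable (ρ Ts) := hmeas Ts _ hwT.2.2.2.1
  have hρTm' : Measurable (ρ' Ts) := hmeas Ts _ hwT.2.2.2.2.1
  have hρjm : Measurable (ρ j) := hmeas j _ hwj.2.2.2.1
  have hρjm' : Measurable (ρ' j) := hmeas j _ hwj.2.2.2.2.1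
  -- clause ⑦ on `[j, Ts)` iterated (✓(L18)) for both towers: the `ℝ≥0∞` cut-off family
  set wgt : (n : ℕ) → GaugeField (F.P n) 0 ↥(Matrix.specialUnitaryGroup (Fin 2) ℂ) → ℝ≥0∞ := fun n U =>
    ENNReal.ofReal (∏ p : Plaq (F.P n) 0, max 0 (min 1 ((24 / 25 * θBal F.L γ b₀ p₀ n - dist1 (GaugeField.plaqHol U p)) / ((24 / 25 - 1 / 2) * θBal F.L γ b₀ p₀ n))))
    with hwgt
  have hwm : ∀ n, Measurable (wgt n) := fun n => ENNReal.measurable_ofReal.comp (measurable_sfCutRamp (1 / 2) (24 / 25) _)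
  have hiter := towerCut_iterate F μ wgt hwm j Ts (Nat.le_of_succ_le hjTs) (fun n hjn hnTs => (hcut n hnTs).1)
  have hiter' := towerCut_iterate F μ' wgt hwm j Ts (Nat.le_of_succ_le hjTs) (fun n hjn hnTs => (hcut n hnTs).2)
  -- the iterated `ℝ≥0∞` weight is `ofReal` of the real multi-level-window weight `χ_{j,Ts}`
  have hW : (fun U => ∏ i ∈ Finset.range (Ts - j), (if h : j + 1 + i ≤ Ts then wgt (j + 1 + i) (descendTo F ℰp (j + 1 + i) Ts h U) else 1)) = fun U => ENNReal.ofReal ((∏ i ∈ Finset.range (Ts - j), (if h : j + 1 + i ≤ Ts then (∏ p : Plaq (F.P (j + 1 + i)) 0, max 0 (min 1 ((24 / 25 * θBal F.L γ b₀ p₀ (j + 1 + i) - dist1 (GaugeField.plaqHol (descendTo F ℰp (j + 1 + i) Ts h U) p)) / ((24 / 25 - 1 / 2) * θBal F.L γ b₀ p₀ (j + 1 + i))))) else 1))) := by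
    funext U
    rw [ENNReal.ofReal_prod_of_nonneg (fun i _ => by
      split_ifs
      · exact sfCutRamp_nonneg _ _ _ _
      · exact zero_le_one)]
    refine Finset.prod_congr rfl (fun i _ => ?_)
    split_ifs with h
    · simp only [hwgt]
    · exact ENNReal.ofReal_one.symm
  rw [hW] at hiter hiter'
  have hconsT : (((fieldMeasure (F.P Ts) 0 ↥(Matrix.specialUnitaryGroup (Fin 2) ℂ)).withDensity (fun U => ENNReal.ofReal (ρ Ts U))).withDensity
      (fun U => ENNReal.ofReal ((∏ i ∈ Finset.range (Ts - j), (if h : j + 1 + i ≤ Ts then (∏ p : Plaq (F.P (j + 1 + i)) 0, max 0 (min 1 ((24 / 25 * θBal F.L γ b₀ p₀ (j + 1 + i) - dist1 (GaugeField.plaqHol (descendTo F ℰp (j + 1 + i) Ts h U) p)) / ((24 / 25 - 1 / 2) * θBal F.L γ b₀ p₀ (j + 1 + i))))) else 1))))).map (descendTo F ℰp j Ts (Nat.le_of_succ_le hjTs)) =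
      (fieldMeasure (F.P j) 0 ↥(Matrix.specialUnitaryGroup (Fin 2) ℂ)).withDensity (fun V => ENNReal.ofReal (ρ j V)) := by
    rw [← hwj.2.1, hiter, hwT.2.1]
  have hconsT' : (((fieldMeasure (F.P Ts) 0 ↥(Matrix.specialUnitaryGroup (Fin 2) ℂ)).withDensity (fun U => ENNReal.ofReal (ρ' Ts U))).withDensity
      (fun U => ENNReal.ofReal ((∏ i ∈ Finset.range (Ts - j), (if h : j + 1 + i ≤ Ts then (∏ p : Plaq (F.P (j + 1 + i)) 0, max 0 (min 1 ((24 / 25 * θBal F.L γ b₀ p₀ (j + 1 + i) - dist1 (GaugeField.plaqHol (descendTo F ℰp (j + 1 + i) Ts h U) p)) / ((24 / 25 - 1 / 2) * θBal F.L γ b₀ p₀ (j + 1 + i))))) else 1))))).map (descendTo F ℰp j Ts (Nat.le_of_succ_le hjTs)) =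
      (fieldMeasure (F.P j) 0 ↥(Matrix.specialUnitaryGroup (Fin 2) ℂ)).withDensity (fun V => ENNReal.ofReal (ρ' j V)) := by
    rw [← hwj.2.2.1, hiter', hwT.2.2.1]
  -- the knit: `q = ∫₀¹ (1−t)·Var_t dt` on the window, continuity in `t`
  have hq := jensenGapMW_eq_integral_variance F γ b₀ p₀ j Ts hjTs hθTs (ρ Ts) (ρ' Ts) hρTm hρTm' (ρ j) (ρ' j) hρjm hρjm'
    hwT.1 hwT.2.2.2.2.2.2.2.1.1 hwT.2.2.2.2.2.2.2.1.2 hwj.1 hwj.2.2.2.2.2.2.2.1.1 hwj.2.2.2.2.2.2.2.1.2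
    (fun U => (∏ i ∈ Finset.range (Ts - j), (if h : j + 1 + i ≤ Ts then (∏ p : Plaq (F.P (j + 1 + i)) 0, max 0 (min 1 ((24 / 25 * θBal F.L γ b₀ p₀ (j + 1 + i) - dist1 (GaugeField.plaqHol (descendTo F ℰp (j + 1 + i) Ts h U) p)) / ((24 / 25 - 1 / 2) * θBal F.L γ b₀ p₀ (j + 1 + i))))) else 1))) hχc hχ0 hχsupp hχpos
    hconsT hconsT' σ hσM hσb hσf mfun hmc hmae σ₀ hσ₀M hbind₀ hfib₀ lam hlam hA1 hA2 hA3
  -- positivity of the window unit `D_j = β_j·θ_j²`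
  have hLpos : (0 : ℝ) < (F.L : ℝ) := by
    have h1L : (1 : ℝ) < (F.L : ℝ) := by exact_mod_cast F.hL.2
    linarith
  have hD : 0 < ((F.L : ℝ) ^ j / γ) * θBal F.L γ b₀ p₀ j ^ 2 := mul_pos (div_pos (pow_pos hLpos j) hγ) (pow_pos hθj 2)
  have hwin4 : ∀ X : GaugeField (F.P j) 0 ↥(Matrix.specialUnitaryGroup (Fin 2) ℂ), PlaqSmall (θBal F.L γ b₀ p₀ j / 4) X → PlaqSmall (θBal F.L γ b₀ p₀ j) X :=
    fun X hX p => (hX p).trans (by linarith)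
  refine ⟨fun _ => 0, 0, w' / 2, le_rfl, by linarith, ?_, fun p => by simp, fun b b' => k' b b' / 2,
    fun b b' => by have := hk'0 b b'; linarith, ?_, ?_⟩
  · -- `0 + θ·(w′∕2)∕D ≤ θ·w′∕D ≤ C·x·x + δ j`
    have h1 : (w' / 2) / (((F.L : ℝ) ^ j / γ) * θBal F.L γ b₀ p₀ j ^ 2) ≤ w' / (((F.L : ℝ) ^ j / γ) * θBal F.L γ b₀ p₀ j ^ 2) :=
      div_le_div_of_nonneg_right (by linarith) hD.le
    have h2 := mul_le_mul_of_nonneg_left h1 hθ.le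
    linarith
  · intro b
    have e : (∑ b', k' b b' / 2 * Real.exp (κ * (b.src.tdist b'.src : ℝ))) =
        (∑ b', k' b b' * Real.exp (κ * (b.src.tdist b'.src : ℝ))) / 2 := by
      rw [Finset.sum_div]
      exact Finset.sum_congr rfl (fun b' _ => by ring)
    rw [e]
    linarith [hrow b]
  · intro b b' v v' U V W Z hv hv' hU hV hW hZ e1 e2 e3 e4 e5 e6
    simp only [zero_mul, Finset.sum_const_zero, mul_zero, sub_zero]
    have key := abs_fourPoint_le_of_eq_integral (S := {X | PlaqSmall (θBal F.L γ b₀ p₀ j) X})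
      (q := fun X => Real.log (ρ j X) - Real.log (ρ' j X) - mfun X)
      (A := fun X t => ProbabilityTheory.variance (fun U => Real.log (ρ Ts U) - Real.log (ρ' Ts U)) (((lam X).withDensity (fun U => ENNReal.ofReal ((∏ i ∈ Finset.range (Ts - j), (if h : j + 1 + i ≤ Ts then (∏ p : Plaq (F.P (j + 1 + i)) 0, max 0 (min 1 ((24 / 25 * θBal F.L γ b₀ p₀ (j + 1 + i) - dist1 (GaugeField.plaqHol (descendTo F ℰp (j + 1 + i) Ts h U) p)) / ((24 / 25 - 1 / 2) * θBal F.L γ b₀ p₀ (j + 1 + i))))) else 1)) * ρ' Ts U))).tilted (fun U => t * (Real.log (ρ Ts U) - Real.log (ρ' Ts U)))))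
      hq (hwin4 U hU) (hwin4 V hV) (hwin4 W hW) (hwin4 Z hZ)
      (W₀ := k' b b' * (‖v‖ / (θBal F.L γ b₀ p₀ j / 4))) (e := ‖v'‖ / (θBal F.L γ b₀ p₀ j / 4))
      (fun t ht => abs_fourPoint_to_bracket (h4 t ht b b' v v' U V W Z hv hv' hU hV hW hZ e1 e2 e3 e4 e5 e6))
    have e : k' b b' * (‖v‖ / (θBal F.L γ b₀ p₀ j / 4)) / 2 * (‖v'‖ / (θBal F.L γ b₀ p₀ j / 4)) =
        k' b b' / 2 * (‖v‖ / (θBal F.L γ b₀ p₀ j / 4)) * (‖v'‖ / (θBal F.L γ b₀ p₀ j / 4)) := by ring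
    rw [e] at key
    exact abs_fourPoint_of_bracket key

end Summit.QuantumFields.YangMills.Theorems.FluctuationComparisonRegPrIntLOrganTangentJensenHOfJvarHV21

end
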